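import Summits.HodgeConjecture.CorCM.GaloisNonCentralInvolution
import HarnessLib

/-!
# A Galois CM field of degree `≥ 64` with a NON-GALOIS subfield of index two is BAD

COR-CM (cell `pub-hodgecm2`), binder seat b04 (gen 32), count-neutral own lane «Galois-CM-type classification».  KERNEL ONLY:
theorems; no definition, no named fact, no `sorry`.  `HC_CM` is neither used nor claimed.  Field-theoretic reading of
`CorCM/GaloisNonCentralInvolution`: an intermediate field `L ⊂ K` with `[K:L] = 2` is the fixed field of an involution
`σ ∈ Gal(K/ℚ)`, and `L/ℚ` is Galois iff `⟨σ⟩` is normal iff `σ` is central.  So: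

* **`exists_simple_degenerate_of_quadratic_subfield_not_isGalois`** — `K` Galois CM, `[K:ℚ] ≥ 64`, `L ≤ K` an intermediate field with
  `[K:L] = 2` which is NOT Galois over `ℚ` ⟹ `K` carries a SIMPLE DEGENERATE abelian variety of dimension `[K:ℚ]/2` with CM by `K`
  (an exceptional Hodge class on some power).
* **`isGalois_of_quadratic_subfield_of_forall_isNondegenerate`** — contrapositive: if every primitive CM type of `K` (`[K:ℚ] ≥ 64`) is
  nondegenerate, every subfield of index `2` in `K` is Galois over `ℚ`.
Typical instances: `K = L·M` with `L` totally real Galois with a non-normal subgroup of order two in its group (dihedral, symmetric,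
alternating, …) and `M` any Galois CM field, `[K:ℚ] ≥ 64`.

## References

* [Shimura1998] G. Shimura, *Abelian Varieties with Complex Multiplication and Modular Functions*, §6.2 Thm. 3, §8.2 Prop. 26, §32.10.
* [Gordon1999HodgeAVSurvey] B. B. Gordon, *A survey of the Hodge conjecture for abelian varieties*, Thm. 6.4, §9.3.
-/

noncomputable section

open CategoryTheory CategoryTheory.Limits NumberField
open scoped BigOperators

namespace Summit.HodgeConjecture.CorCM.GaloisModels

open Literature.NumberTheory.ComplexMultiplication
open Literature.AlgebraicGeometry.Motives (AbelianVariety CMType)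
open Literature.AlgebraicGeometry.HodgeTheory
open Literature.AlgebraicGeometry.ComplexMultiplication (IsCMTypeRealisation)
open Literature.AlgebraicGeometry.Pohlmann1968
open Literature.Barriers.HodgeConjecture (divisorClassesSpan)

variable {K : Type} [Field K] [NumberField K] [IsCMField K] [IsGalois ℚ K]

/-- **A NON-GALOIS SUBFIELD OF INDEX TWO MAKES A GALOIS CM FIELD OF DEGREE `≥ 64` BAD.** [cite: Shimura1998, §6.2 Thm. 3, §8.2 Prop. 26
and §32.10] [cite: Gordon1999HodgeAVSurvey, Thm. 6.4 and §9.3] -/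
theorem exists_simple_degenerate_of_quadratic_subfield_not_isGalois (L : IntermediateField ℚ K)
    (hL : Module.finrank L K = 2) (hnG : ¬ IsGalois ℚ L) (hdeg : 64 ≤ Module.finrank ℚ K) :
    ∃ (Φ : CMType K) (φ₀ : K →+* ℂ) (A : AbelianVariety ℂ) (ι : 𝓞 K →+* End A)
      (θ : K →+* Module.End ℂ (complexBetti A.X 1)),
      IsPrimitive (ℂ ≃+* ℂ) Φ.1 φ₀ ∧ ¬ IsNondegenerate Φ ∧ IsCMTypeRealisation Φ A ι θ ∧ A.IsSimple ∧
      A.dim = Module.finrank ℚ K / 2 ∧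
      ∃ n p : ℕ, ∃ x : complexBetti (⨁ fun _ : Fin n => A).X (2 * p), IsRationalClass x ∧
        IsOfHodgeType (⨁ fun _ : Fin n => A).dim (⨁ fun _ : Fin n => A).X (2 * p) p p x ∧
        x ∉ divisorClassesSpan (⨁ fun _ : Fin n => A).X (⨁ fun _ : Fin n => A).dim p := by
  classical
  set H := L.fixingSubgroup with hHdef
  have hcard : Nat.card H = 2 := by rw [hHdef, IsGalois.card_fixingSubgroup_eq_finrank]; exact hL
  -- `H = {1, σ}`
  obtain ⟨σ, hσ1, huniq⟩ := (Nat.card_eq_two_iff' (1 : H)).1 hcard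
  have hmem : ∀ h : H, h = 1 ∨ h = σ := fun h => by
    by_cases hh : h = 1
    · exact Or.inl hh
    · exact Or.inr (huniq h hh)
  set s : K ≃ₐ[ℚ] K := (σ : K ≃ₐ[ℚ] K) with hsdef
  have hs1 : s ≠ 1 := fun h => hσ1 (Subtype.ext h)
  have hss : s * s = 1 := by
    rcases hmem (σ * σ) with h | h
    · exact congrArg Subtype.val h
    · exact absurd (mul_left_cancel (a := σ) (h.trans (mul_one σ).symm)) hσ1
  -- `s` is not central: otherwise `H` is normal and `L = K^H` is Galois over `ℚ`
  have hnc : ∃ τ : K ≃ₐ[ℚ] K, τ * s ≠ s * τ := by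
    by_contra hall
    have hall' : ∀ τ : K ≃ₐ[ℚ] K, τ * s = s * τ := fun τ => by by_contra h; exact hall ⟨τ, h⟩
    haveI : H.Normal := ⟨fun n hn g => by
      rcases hmem ⟨n, hn⟩ with h | h
      · have : n = 1 := congrArg Subtype.val h
        rw [this, mul_one, mul_inv_cancel]; exact one_mem _
      · have : n = s := congrArg Subtype.val h
        rw [this, hall' g, mul_assoc, mul_inv_cancel, mul_one]; exact σ.2⟩
    haveI : IsGalois ℚ (IntermediateField.fixedField H) := IsGalois.of_fixedField_normal_subgroup H
    exact hnG (IsGalois.of_algEquiv (IntermediateField.equivOfEq (IsGalois.fixedField_fixingSubgroup L)))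
  exact exists_simple_degenerate_of_noncentral_involution_gal s hss hnc hdeg

/-- **GOOD ⟹ every subfield of index two is Galois over `ℚ`** (`[K:ℚ] ≥ 64`). [cite: Shimura1998, §8.2 Prop. 26 and §32.10] -/
theorem isGalois_of_quadratic_subfield_of_forall_isNondegenerate (hdeg : 64 ≤ Module.finrank ℚ K)
    (hgood : ∀ (Φ : CMType K) (φ : K →+* ℂ), IsPrimitive (ℂ ≃+* ℂ) Φ.1 φ → IsNondegenerate Φ)
    (L : IntermediateField ℚ K) (hL : Module.finrank L K = 2) : IsGalois ℚ L := by
  by_contra hnG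
  obtain ⟨Φ, φ₀, A, ι, θ, H1, H2, -⟩ := exists_simple_degenerate_of_quadratic_subfield_not_isGalois L hL hnG hdeg
  exact H2 (hgood Φ φ₀ H1)

end Summit.HodgeConjecture.CorCM.GaloisModels

end
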